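import Summits.HodgeConjecture.HodgeConjecture.Theorems.R90S6HeckeEigenpolyTwoSymmetric   -- ★ W3-d′ `R90.S6.hecke_eigenpoly_two_symmetric` (p862317)
import Summits.HodgeConjecture.HodgeConjecture.Theorems.R90S6HeckeEigenpolyThreeExists    -- ★ W3-c `R90.S6.exists_hecke_eigenpoly_three` (p862233)
import HarnessLib

/-!
# R90 · S6 «Ch. 14.1–14.5 stable trace formula» — WAVE 5 card W5-a: the SATAKE-GRAPH PARTNER MAP `φ ↦ φ^H` IS ONTO `ℋ(U(J₀,2)(E_w), K₀)`
# (`Theorems/R90S6SatakeGraphPartnerSurjective.lean`)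

Cell `hodgecm-mathlib`, crux H413 (`stmt-HodgeConjecture-24833`), route of record `HCCMUnconditional`; programme R90-TF, section S6
(base `R90-C14`, dealer R90-C14-plan (g0)), seat K2E1-p10 (g4) (free E1 hand, W5 DEAL 2026-09-04T22:05:19Z); card W5-a of the sheet
`R90/R90-C14-plan/g0/S6_wave5_targets.v1.R90-C14-plan-g0.lean` sha16 9b668b58b52808d7 :27–:36 (signature token-identical, namespace segment
`.Wave5` dropped).  Helper lane `--supports stmt-HodgeConjecture-24833 --as helper`; ONE theorem (no definition, no instance, no notation, no
named fact, no `sorry`); imports = the two ★ W3 Theorems files (Theorems → Theorems) + HarnessLib (no Lines import).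

THE PRINT [Rogawski1990, §4.9 Prop. 4.9.1 p. 55]: the map `f ↦ ξ̂_H(f)` of unramified Hecke algebras is characterised on the rank-one
parameter line by `ξ̂_H(f)^∧(z) = f^∧(−z)`; [CartierCorvallis1979, §IV Thm. 4.1, Cor. 4.2], [Minguez2011, §4] (Satake: `ℋ(G,K) ≅ ℂ[z, z⁻¹]^W`,
`W = {z ↦ z⁻¹}` in relative rank one, for `U(J₀,3)` and `U(J₀,2)` at an inert unramified place alike).  Since BOTH algebras are `ℂ[z + z⁻¹]`
on their parameter lines and `z ↦ −z` preserves `ℂ[z + z⁻¹]`, the graph `{(φ, φ^H)}` (★ W3-a existence `R90.S6.satakeGraph_partner_exists`,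
★ W3-b uniqueness `R90.S6.satakeGraph_partner_unique`) projects ONTO the `U(J₀,2)` side: every `φH` is a partner.

PROOF.  W3-d′ (★ `hecke_eigenpoly_two_symmetric`) gives `Q ∈ ℂ[X]` with `λ_{(z,1)}(φH) = Q(z + z⁻¹)`; W3-c (★ `exists_hecke_eigenpoly_three`)
applied to `Q ∘ (−X)` gives `φ` with `λ_{(z,1,1)}(φ) = Q(−(z + z⁻¹))` for all `z`; at `−z`: `(−z) + (−z)⁻¹ = −(z + z⁻¹)`, so
`λ_{(−z,1,1)}(φ) = Q(z + z⁻¹) = λ_{(z,1)}(φH)`.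

WHY (S6, `ov_cm`-free, Q-S1-neutral): supply lemma for FILE D `Cruxes/H413/Lines/R90_S6_FloorE1D.lean` § (E1-c) `SatakeGraph` ∕ W4
`satakeGraphPartnerAlgHom` and the S6 ED. 2b Hecke separation on BOTH sides of (14.6.1) — every Hecke operator on `H_w` is a partner, so the
`H`-side sums separate as `f_w` varies (with W3-b the partner map is a bijection `ℋ₃ → ℋ₂`; W5-c upgrades W4's hom to an `AlgEquiv`).
HONEST LABEL: supply lemma for FILE D § (E1-c) ∕ S6 ED. 2b Hecke separation; pays no socket by itself; local spherical Hecke-algebra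
bookkeeping, proves no printed global statement.  HC_CM is proved only modulo the 7 printed citations (2 remaining named inputs: hLiu418 =
stmt-HodgeConjecture-24832, h413 = stmt-HodgeConjecture-24833) until rung 0 closes; count-neutral helper.

## Tree search
★ `R90.S6.hecke_eigenpoly_two_symmetric` (W3-d′), ★ `R90.S6.exists_hecke_eigenpoly_three` (W3-c); Mathlib `Polynomial.eval_comp`, `eval_neg`,
`eval_X`, `Units.val_neg`, `inv_neg`.  Dedup: `rg "partner_surjective|PartnerSurjective"` over `Theorems/` + `Literature/NumberTheory/Automorphic/`
— no hit (only the sheet's `sorry` under `R90/`, not in tree).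

## References
* [Rogawski1990] J. D. Rogawski, *Automorphic Representations of Unitary Groups in Three Variables*, Ann. of Math. Stud. 123 (1990), §4.9
  Prop. 4.9.1 p. 55 (`ξ̂_H(f)^∧(z) = f^∧(−z)`); §4.5 p. 45 (unramified `λ_β`).
* [CartierCorvallis1979] P. Cartier, *Representations of 𝔭-adic groups: a survey*, PSPM 33.1 (1979), §IV Thm. 4.1, Cor. 4.2.
* [Minguez2011] A. Mínguez, *Unramified representations of unitary groups*, in *On the stabilization of the trace formula* (2011), §4.
-/

set_option autoImplicit false
-- the mandated namespace repeats the single-problem summit's segment (`HodgeConjecture.HodgeConjecture`)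
set_option linter.dupNamespace false

noncomputable section

open NumberField IsDedekindDomain Polynomial
open Literature.NumberTheory.Automorphic Literature.NumberTheory.Automorphic.HermitianLattice Literature.NumberTheory.Automorphic.UnitaryGroup

namespace Summit.HodgeConjecture.HodgeConjecture.R90.S6

variable {F E : Type} [Field F] [NumberField F] [Field E] [NumberField E] [Algebra F E] [Algebra.IsQuadraticExtension F E]
  (c : E ≃ₐ[F] E) (hc1 : c ≠ 1) (v : HeightOneSpectrum (𝓞 F)) (w : PlacesOver E v) (hw : c • w.1 = w.1)
  (hv : Algebra.IsUnramifiedIn (𝓞 E) v.asIdeal)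

/-- **W5-a — the Satake-graph partner map is ONTO `ℋ(U(J₀,2)(E_w), K₀)`** [Rogawski1990, §4.9 Prop. 4.9.1 p. 55 (`ξ̂_H(f)^∧(z) = f^∧(−z)`);
CartierCorvallis1979 §IV Thm. 4.1, Cor. 4.2]: for every `φH ∈ ℋ(U(J₀,2)(E_w), K₀)` there is `φ ∈ ℋ(U(J₀,3)(E_w), K₀)` with
`λ^{(2)}_{(z,1)}(φH) = λ^{(3)}_{(−z,1,1)}(φ)` for ALL `z ∈ ℂˣ` — take `Q` with `λ_{(z,1)}(φH) = Q(z + z⁻¹)` (★ W3-d′) and `φ` with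
`λ_{(z,1,1)}(φ) = (Q ∘ (−X))(z + z⁻¹)` (★ W3-c); then `λ_{(−z,1,1)}(φ) = Q(−((−z) + (−z)⁻¹)) = Q(z + z⁻¹)`.  (Sheet `S6_wave5_targets.v1`
9b668b58b52808d7 :27–:36 token-for-token; supply lemma for FILE D § (E1-c) ∕ S6 ED. 2b Hecke separation; pays no socket by itself.)
[cite: Rogawski1990, §4.9 Prop. 4.9.1 p. 55] [cite: CartierCorvallis1979, §IV Thm. 4.1, Cor. 4.2] [cite: Minguez2011, §4] -/
theorem satakeGraph_partner_surjective
    (φH : heckeAlgebra ℂ ↥(unitaryGroupOfForm (galAdicCompletionMap (L := E) c hw) ((StdForm.antidiagonal 2).over (w.1.adicCompletion E)))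
      (unitaryInt (galAdicCompletionMap (L := E) c hw) ((StdForm.antidiagonal 2).over (w.1.adicCompletion E)))) :
    ∃ φ : heckeAlgebra ℂ ↥(unitaryGroupOfForm (galAdicCompletionMap (L := E) c hw) ((StdForm.antidiagonal 3).over (w.1.adicCompletion E)))
        (unitaryInt (galAdicCompletionMap (L := E) c hw) ((StdForm.antidiagonal 3).over (w.1.adicCompletion E))),
      ∀ z : ℂˣ, unitaryHeckeEigencharacterAdic c hc1 v w hw hv ![z, 1] φH =
        unitaryHeckeEigencharacterAdic c hc1 v w hw hv ![-z, 1, 1] φ := by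
  -- `λ_{(z,1)}(φH) = Q(z + z⁻¹)` (W3-d′)
  obtain ⟨Q, hQ⟩ := hecke_eigenpoly_two_symmetric c hc1 v w hw hv φH
  -- `λ_{(z,1,1)}(φ) = (Q ∘ (−X))(z + z⁻¹)` (W3-c at `Q.comp (−X)`)
  obtain ⟨φ, hφ⟩ := exists_hecke_eigenpoly_three c hc1 v w hw hv (Q.comp (-X))
  refine ⟨φ, fun z => ?_⟩
  rw [hQ z, hφ (-z), eval_comp, eval_neg, eval_X]
  -- `(−z) + (−z)⁻¹ = −(z + z⁻¹)`
  congr 1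
  rw [Units.val_neg, inv_neg]
  ring

end Summit.HodgeConjecture.HodgeConjecture.R90.S6

end
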